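import Summits.QuantumFields.YangMills.Theorems.BalabanUVNodesN15KingModelFullPropagatorHolderPowerLaws
import Summits.QuantumFields.YangMills.Theorems.BalabanUVNodesN15KingModelFullPropagatorMixedOperatorSupp
import Summits.QuantumFields.YangMills.Theorems.BalabanUVNodesN15KingModelTorusPowerSums

/-!
# BalabanUVNodes ∕ N15 — THE KING-MODEL RUNG, CURVED EDITION (PART Ψ-a): THE KERNEL AND LATTICE BRICKS OF THE CALDERÓN–ZYGMUND ESTIMATE
# BEHIND [B9] (3.45) AT `U ≡ 1` — the mixed second difference of King's full `A = 0` propagator as a power law WITH the block decay,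
# its Hölder quotient in the observation point as a power law WITH the block decay (both argument orders), ball counts and dyadic TAIL sums
# `Σ_{|y − x| > S} |y − x|^{−t−d′} ≲ S^{−t}` on King's tori, uniformly in the periods
# (Track A, DAG node N15 = NE2; FAN-OUT v1.1 §N15 s3 «KING-MODEL RUNG … + the one-line statement of what the curved case adds»)

HONEST FRAMING.  Count-neutral kernel ∕ lattice bookkeeping (cell `pub-ymgap`, seat `pub-ymgap-dag-n15-e` g10; `--supports stmt-QuantumFields-20544
--as helper` = K3⁷ `SpineGivenEndpointR13SepCoPH`, WORDS-143).  TEMPLATE LITERATURE, `A = 0`: C. King's scalar U(1)-Higgs MODEL on finite tori ([King1986]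
(2.13)–(2.17) p. 653, (3.62) p. 663, Prop. 3.7 (3.63)∕(3.65) p. 663 with `|a| = |b| = 1`), NOT Bałaban's covariant objects.  [Balaban1985BackgroundPropagators]
Thm 3.1 p. 398 prints (3.45): «`‖ζ∇_UG(U)∇*_Uλ‖_α ≤ B′₀(ε, α)(L^jη)^{−α}(‖ζ‖^ξ_α + |ζ|)e^{−δ₀d(y, y′)}(‖λ‖_{α+ε} + |λ|)`, `supp λ ⊂ Δ̃(y′)`» — the HÖLDER NORM of
the mixed object.  At `U ≡ 1`, for King's full `A = 0` propagator `A₀⁻¹ = G_K(T_ε, 0)`, that norm is estimated in the sequels (parts Ψ-b∕Ψ-c) by a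
Calderón–Zygmund split on the torus; THIS FILE supplies the bricks.  Everything here is decided in the MODEL; NOT the printed proposition (covariant `G(U)` over
`Reg335`, multiscale carrier); NE2⁺ is NOT PRINTED and not proved; NOT a node discharge; nothing continuum ∕ ℝ⁴ ∕ OS ∕ mass-gap ∕ Clay.  0 `sorry`, 0 `def`,
standard axioms.

CONTENT.
* §1 ★ `fullPropDD_powerLaw_decay_unif` (`x ≠ y`: `|DD_{μν}G(x, y)| ≤ C·((L^K)∕r)^{d+1}·e^{−δ|B(x) − B(y)|}` — part V-a `fullPropDD_profile_decay_unif` with the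
  level sum evaluated by part R-b `levelSum_le_powerLaw`); ★ `fullPropDD_holder_powerLaw_decay_unif` (`y ≠ x, x′`:
  `(ρ∕N)^{−α}|DD_{μν}G(x′, y) − DD_{μν}G(x, y)| ≤ C·((L^K)∕m)^{d+1}((L^K)∕m)^α·e^{−δ·min(|B(x) − B(y)|, |B(x′) − B(y)|)}` — part Y-b's profile, half of every
  level's rate paying for the block decay (R-d `exp_level_split`), the other half summed by U-c `levelSum_rpow_le_powerLaw`); `fullPropDD_holder_powerLaw_decay_unif_snd`
  (the same with the Hölder difference in the SECOND argument — the form in which the kernel of `F(x) = N·((A₀⁻¹∇*_μλ)(x + e_ν) − (A₀⁻¹∇*_μλ)(x))` appears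
  (V-b `inv_deriv_adjDeriv_eq_sum`) — by the symmetry `G(x, y) = G(y, x)`, Q4a `constrainedProp_symm`).
* §2 torus geometry, uniformly in the periods: `exists_natCast_eq_tdistT` (the distance is an integer), `tdist_le_sup_period`, `card_ball_tdistT_le`
  (`#{y : |y − x| ≤ r} ≤ (2⌊r⌋₊ + 1)^{d′}` on `Tor K`, the tree's `B5TorusCover.ballCard_le` through `toSite`), `tdist_rpow_tail_le_aux`∕`tdist_rpow_tail_le`
  (`Σ_{|y−x| > 2^k}|y − x|^{−t−d′} ≤ 5^{d′}(2^{−t})^k∕(1 − 2^{−t})`, by part Ω's dyadic shells `tdist_rpow_shell_le` read at the exponent `θ = −t`),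
  ★ `powerSum_tail_le_tdistT` (`Σ_{|y−x| > S}|y − x|^{−t−d′} ≤ (5^{d′}2^t∕(1 − 2^{−t}))·S^{−t}` for real `S ≥ 1`, on King's `Tor K`).
WHAT THE CURVED CASE ADDS (one line): nothing here is background-dependent except §1, whose curved version is (3.65) for `G_k(U)` over `Reg335`.
HONEST SCOPE.  (i) `A = 0`, periodic b.c., odd `L ≥ 3`, `0 < m² ≤ m₀²`, cubes `2L^e`, `0 < α < 1`; (ii) lattice units of level `K`, sup torus distance,
forward η-differences; (iii) §2 is folklore lattice geometry; (iv) not Bałaban's `G_k(U)`; not a discharge.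
Locators: [King1986] (2.13)–(2.17) p. 653, (3.62), Prop. 3.7 (3.63)∕(3.65) p. 663; [Balaban1985BackgroundPropagators] Thm 3.1 (3.45) p. 398;
[Balaban1983RegularityDecay] Theorem (1.10) p. 573, §5 (5.7)–(5.8) p. 594.
-/

noncomputable section

namespace Summit.QuantumFields.YangMills.BalabanUVNodes.N15KingModelRung.Curved

open Real Finset Matrix
open Literature.MathematicalPhysics.QuantumFieldTheory.Balaban1983to89.B4Sect5Torus (TSite tdist tdist_nonneg ccoord)
open Literature.MathematicalPhysics.QuantumFieldTheory.Balaban1983to89.B4TorusKernel.MultiPeriod (circAbs two_mul_circAbs_le circAbs_nonneg)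
open Literature.MathematicalPhysics.QuantumFieldTheory.Balaban1983to89.B5TorusCover (ballCard_le)
open Literature.MathematicalPhysics.QuantumFieldTheory.Balaban1983to89.B5Prop11Plancherel (Tor fine unitVec)
open Literature.MathematicalPhysics.QuantumFieldTheory.King1986 (aK aK_pos)
open Literature.MathematicalPhysics.QuantumFieldTheory.King1986.Torus (constrainedProp blockOf tdistT tdistT_nonneg tdistT_symm toSite
  toSite_injective one_le_period)

variable {d : ℕ} (L : ℕ) [NeZero L]

/-! ## §1 The mixed second difference: power laws WITH the block decay -/

/-- **THE POWER LAW OF THE MIXED SECOND DIFFERENCE, WITH THE BLOCK DECAY**: for odd `L ≥ 3`, `a > 0`, `m₀² ≥ 0` there are `C, δ > 0` such that for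
EVERY `K ≥ 1` (`N = L^K`), cube `2L^e`, mass `0 < m² ≤ m₀²`, directions `μ, ν` and fine points `x ≠ y` at fine distance `r`:
`|DD_{μν}G(x, y)| ≤ C·((L^K)∕r)^{d+1}·e^{−δ|B(x) − B(y)|_M}` — part V-a's profile-with-decay with the level sum evaluated (R-b `levelSum_le_powerLaw` at
`p = d + 1`): King's (3.63) with `|a| = |b| = 1` and the (3.7)-type decay, SUMMED over (2.17).
[cite: King1986, Prop. 3.7 (3.63) p.663, Theorem 3.3 (3.7) p.656, (2.17) p.653; Balaban1985BackgroundPropagators, (3.44)–(3.45) p.398 (the kernel)] -/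
theorem fullPropDD_powerLaw_decay_unif (hLodd : Odd L) (hL : 2 ≤ L) {a : ℝ} (ha : 0 < a) {m0sq : ℝ} (hm0 : 0 ≤ m0sq) :
    ∃ C δ : ℝ, 0 < C ∧ 0 < δ ∧ ∀ (K : ℕ), 1 ≤ K → ∀ (N : ℕ) [NeZero N], N = L ^ K →
      ∀ (e : ℕ) (M : Fin (d + 1) → ℕ) [∀ μ, NeZero (M μ)], (∀ μ, M μ = 2 * L ^ e) →
      ∀ (msq : ℝ), 0 < msq → msq ≤ m0sq → ∀ (μ ν : Fin (d + 1)) (x y : Tor (fine N M)), x ≠ y →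
        |(N : ℝ) * ((N : ℝ) * (constrainedProp N M (aK a L K) (((N : ℕ) : ℝ) ^ 2) msq (x + unitVec (fine N M) μ) (y + unitVec (fine N M) ν)
              - constrainedProp N M (aK a L K) (((N : ℕ) : ℝ) ^ 2) msq x (y + unitVec (fine N M) ν))
            - (N : ℝ) * (constrainedProp N M (aK a L K) (((N : ℕ) : ℝ) ^ 2) msq (x + unitVec (fine N M) μ) y
              - constrainedProp N M (aK a L K) (((N : ℕ) : ℝ) ^ 2) msq x y))|
          ≤ C * (((L : ℝ) ^ K) / tdistT (fine N M) x y) ^ (d + 1)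
              * Real.exp (-(δ * tdistT M (blockOf N M x) (blockOf N M y))) := by
  have hLr : (2 : ℝ) ≤ L := by exact_mod_cast hL
  obtain ⟨C₀, δ, hC₀, hδ, H⟩ := fullPropDD_profile_decay_unif (d := d) L hLodd hL ha hm0
  set Kp : ℝ := (2 * ((d + 1) + 1).factorial / (δ / L) ^ ((d + 1) + 1) + 2) / (L : ℝ) ^ (d + 1) with hKp
  have hδL : 0 < δ / L := div_pos hδ (by positivity)
  have hKp0 : 0 < Kp := by positivity
  refine ⟨C₀ * Kp, δ, mul_pos hC₀ hKp0, hδ, ?_⟩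
  intro K hK N _ hN e M _ hM msq hmsq hcap μ ν x y hxy
  have h := H K hK N hN e M hM msq hmsq hcap μ ν x y
  set r : ℝ := tdistT (fine N M) x y with hrdef
  have hr : 1 ≤ r := one_le_tdistT_of_ne (fine N M) hxy
  have hNc : (N : ℝ) = (L : ℝ) ^ K := by rw [hN, Nat.cast_pow]
  have hs : ∑ i ∈ Finset.range K, ((L : ℝ) ^ (d + 1) / (L : ℝ) ^ 2 * L * L) ^ i * Real.exp (-(δ * (r * (L : ℝ) ^ i / (N : ℝ))))
      = ∑ i ∈ Finset.range K, ((L : ℝ) ^ (d + 1)) ^ i * Real.exp (-(δ * (r * (L : ℝ) ^ i / (L : ℝ) ^ K))) :=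
    Finset.sum_congr rfl fun i _ => by rw [LamL2_eq_pow L hL, hNc]
  rw [hs] at h
  have hsum := levelSum_le_powerLaw hLr hδ (by omega : 1 ≤ d + 1) K hr
  have hE : 0 ≤ Real.exp (-(δ * tdistT M (blockOf N M x) (blockOf N M y))) := (Real.exp_pos _).le
  calc _ ≤ C₀ * (∑ i ∈ Finset.range K, ((L : ℝ) ^ (d + 1)) ^ i * Real.exp (-(δ * (r * (L : ℝ) ^ i / (L : ℝ) ^ K))))
          * Real.exp (-(δ * tdistT M (blockOf N M x) (blockOf N M y))) := h
    _ ≤ C₀ * (Kp * (((L : ℝ) ^ K) / r) ^ (d + 1)) * Real.exp (-(δ * tdistT M (blockOf N M x) (blockOf N M y))) :=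
        mul_le_mul_of_nonneg_right (mul_le_mul_of_nonneg_left hsum hC₀.le) hE
    _ = C₀ * Kp * (((L : ℝ) ^ K) / r) ^ (d + 1) * Real.exp (-(δ * tdistT M (blockOf N M x) (blockOf N M y))) := by ring

/-- **KING'S (3.65), `|a| = |b| = 1`, SUMMED, AS A POWER LAW WITH THE BLOCK DECAY** (`0 < α < 1`): there are `C, δ > 0` such that for all `K ≥ 1`
(`N = L^K`), cubes `2L^e`, `0 < m² ≤ m₀²`, `μ, ν`, `x, x′` and `y ≠ x, x′`:
`(|x − x′|∕N)^{−α}·|DD_{μν}G(x′, y) − DD_{μν}G(x, y)| ≤ C·((L^K)∕m)^{d+1}·((L^K)∕m)^α·e^{−δ·min(|B(x) − B(y)|, |B(x′) − B(y)|)}`, `m = min(|x − y|, |x′ − y|)`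
— part Y-b's profile `Σ_{i<K}(ΛL²)^i(L^i)^α e^{−δ₀mL^i∕N}`: half of every level's rate pays for the unit-block decay (`N·D ≤ m + (N − 1)`, part O-a
`mul_tdistT_blockOf_le`, R-d `exp_level_split`), the other half is summed by U-c `levelSum_rpow_le_powerLaw` (`p = d + 1`); the kernel of [B9]'s (3.45) at
`U ≡ 1` in Calderón–Zygmund form with the printed exponential decay between blocks.
[cite: King1986, (3.62) p.663, Prop. 3.7 (3.63)/(3.65) p.663, Theorem 3.3 (3.7) p.656; Balaban1985BackgroundPropagators, Thm 3.1 (3.45) p.398] -/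
theorem fullPropDD_holder_powerLaw_decay_unif (hLodd : Odd L) (hL : 2 ≤ L) {a : ℝ} (ha : 0 < a) {m0sq : ℝ}
    (hm0 : 0 ≤ m0sq) {α : ℝ} (hα0 : 0 < α) (hα1 : α < 1) :
    ∃ C δ : ℝ, 0 < C ∧ 0 < δ ∧ ∀ (K : ℕ), 1 ≤ K → ∀ (N : ℕ) [NeZero N], N = L ^ K →
      ∀ (e : ℕ) (M : Fin (d + 1) → ℕ) [∀ μ, NeZero (M μ)], (∀ μ, M μ = 2 * L ^ e) →
      ∀ (msq : ℝ), 0 < msq → msq ≤ m0sq → ∀ (μ ν : Fin (d + 1)) (x x' y : Tor (fine N M)), x ≠ y → x' ≠ y →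
        (tdistT (fine N M) x x' / (N : ℝ)) ^ (-α) *
          |(N : ℝ) * ((N : ℝ) * (constrainedProp N M (aK a L K) (((N : ℕ) : ℝ) ^ 2) msq (x' + unitVec (fine N M) μ) (y + unitVec (fine N M) ν)
              - constrainedProp N M (aK a L K) (((N : ℕ) : ℝ) ^ 2) msq x' (y + unitVec (fine N M) ν))
            - (N : ℝ) * (constrainedProp N M (aK a L K) (((N : ℕ) : ℝ) ^ 2) msq (x' + unitVec (fine N M) μ) y
              - constrainedProp N M (aK a L K) (((N : ℕ) : ℝ) ^ 2) msq x' y))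
            - ((N : ℝ) * ((N : ℝ) * (constrainedProp N M (aK a L K) (((N : ℕ) : ℝ) ^ 2) msq (x + unitVec (fine N M) μ) (y + unitVec (fine N M) ν)
              - constrainedProp N M (aK a L K) (((N : ℕ) : ℝ) ^ 2) msq x (y + unitVec (fine N M) ν))
            - (N : ℝ) * (constrainedProp N M (aK a L K) (((N : ℕ) : ℝ) ^ 2) msq (x + unitVec (fine N M) μ) y
              - constrainedProp N M (aK a L K) (((N : ℕ) : ℝ) ^ 2) msq x y)))|
          ≤ C * (((L : ℝ) ^ K / min (tdistT (fine N M) x y) (tdistT (fine N M) x' y)) ^ (d + 1)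
                * ((L : ℝ) ^ K / min (tdistT (fine N M) x y) (tdistT (fine N M) x' y)) ^ α)
              * Real.exp (-(δ * min (tdistT M (blockOf N M x) (blockOf N M y)) (tdistT M (blockOf N M x') (blockOf N M y)))) := by
  obtain ⟨C, δ, hC, hδ, H⟩ := fullPropDD_holder_profile_unif (d := d) L hLodd hL ha hm0 hα0 hα1
  have hLr : (2 : ℝ) ≤ L := by exact_mod_cast hL
  have hL1 : (1 : ℝ) ≤ L := by linarith
  have hδ2 : 0 < δ / 2 := by positivity
  set Kp : ℝ := (2 * (d + 1 + 1).factorial / (δ / 2 / L) ^ (d + 1 + 1) + 2) / (L : ℝ) ^ (d + 1)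
      + (2 * (d + 1 + 1 + 1).factorial / (δ / 2 / L) ^ (d + 1 + 1 + 1) + 2) / (L : ℝ) ^ (d + 1 + 1) with hKp
  have hδL : 0 < δ / 2 / L := div_pos hδ2 (by positivity)
  have hKp0 : 0 < Kp := by positivity
  refine ⟨C * Real.exp (δ / 2) * Kp, δ / 2, by positivity, hδ2, ?_⟩
  intro K hK N _ hN e M _ hM msq hmsq hcap μ ν x x' y hxy hx'y
  have h := H K hK N hN e M hM msq hmsq hcap μ ν x x' y
  set m : ℝ := min (tdistT (fine N M) x y) (tdistT (fine N M) x' y) with hmdef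
  set Dm : ℝ := min (tdistT M (blockOf N M x) (blockOf N M y)) (tdistT M (blockOf N M x') (blockOf N M y)) with hDmdef
  have hm1 : 1 ≤ m := le_min (one_le_tdistT_of_ne (fine N M) hxy) (one_le_tdistT_of_ne (fine N M) hx'y)
  have hm0 : 0 ≤ m := by linarith
  have hN' : (N : ℝ) = (L : ℝ) ^ K := by rw [hN, Nat.cast_pow]
  have hN1 : (1 : ℝ) ≤ (N : ℝ) := by rw [hN]; exact_mod_cast Nat.one_le_pow K L (by omega)
  have hN0 : (0 : ℝ) ≤ (N : ℝ) := by linarith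
  -- `N·Dm ≤ m + (N − 1)`: both block distances are controlled by the corresponding fine distances
  have hDm : (N : ℝ) * Dm ≤ m + ((N : ℝ) - 1) := by
    have h1 := mul_tdistT_blockOf_le N M x y
    have h2 := mul_tdistT_blockOf_le N M x' y
    have e1 : (N : ℝ) * Dm ≤ tdistT (fine N M) x y + ((N : ℝ) - 1) :=
      (mul_le_mul_of_nonneg_left (min_le_left _ _) hN0).trans h1
    have e2 : (N : ℝ) * Dm ≤ tdistT (fine N M) x' y + ((N : ℝ) - 1) :=
      (mul_le_mul_of_nonneg_left (min_le_right _ _) hN0).trans h2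
    calc (N : ℝ) * Dm ≤ min (tdistT (fine N M) x y + ((N : ℝ) - 1)) (tdistT (fine N M) x' y + ((N : ℝ) - 1)) := le_min e1 e2
      _ = m + ((N : ℝ) - 1) := min_add_add_right _ _ _
  -- split every level's exponential
  have hsplit : ∑ i ∈ Finset.range K, ((L : ℝ) ^ (d + 1) / (L : ℝ) ^ 2 * L * L) ^ i * ((L : ℝ) ^ i) ^ α
        * Real.exp (-(δ * (m * (L : ℝ) ^ i / (N : ℝ))))
      ≤ Real.exp (δ / 2) * Real.exp (-(δ / 2 * Dm)) * ∑ i ∈ Finset.range K, ((L : ℝ) ^ (d + 1)) ^ i * ((L : ℝ) ^ i) ^ α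
        * Real.exp (-(δ / 2 * (m * (L : ℝ) ^ i / (L : ℝ) ^ K))) := by
    rw [Finset.mul_sum]
    refine Finset.sum_le_sum fun i _ => ?_
    have hs : (1 : ℝ) ≤ (L : ℝ) ^ i := one_le_pow₀ hL1
    have he := exp_level_split hδ.le hm0 hs hN1 hDm
    rw [LamL2_eq_pow L hL, ← hN']
    calc ((L : ℝ) ^ (d + 1)) ^ i * ((L : ℝ) ^ i) ^ α * Real.exp (-(δ * (m * (L : ℝ) ^ i / (N : ℝ))))
        ≤ ((L : ℝ) ^ (d + 1)) ^ i * ((L : ℝ) ^ i) ^ α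
          * (Real.exp (δ / 2) * Real.exp (-(δ / 2 * Dm)) * Real.exp (-(δ / 2 * (m * (L : ℝ) ^ i / (N : ℝ))))) :=
          mul_le_mul_of_nonneg_left he (by positivity)
      _ = Real.exp (δ / 2) * Real.exp (-(δ / 2 * Dm)) * (((L : ℝ) ^ (d + 1)) ^ i * ((L : ℝ) ^ i) ^ α
          * Real.exp (-(δ / 2 * (m * (L : ℝ) ^ i / (N : ℝ))))) := by ring
  have hsum := levelSum_rpow_le_powerLaw hLr hδ2 (p := d + 1) (by omega) hα0.le hα1.le K hm1
  have hE : 0 ≤ Real.exp (δ / 2) * Real.exp (-(δ / 2 * Dm)) := by positivity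
  calc _ ≤ C * ∑ i ∈ Finset.range K, ((L : ℝ) ^ (d + 1) / (L : ℝ) ^ 2 * L * L) ^ i * ((L : ℝ) ^ i) ^ α
            * Real.exp (-(δ * (m * (L : ℝ) ^ i / (N : ℝ)))) := h
    _ ≤ C * (Real.exp (δ / 2) * Real.exp (-(δ / 2 * Dm)) * ∑ i ∈ Finset.range K, ((L : ℝ) ^ (d + 1)) ^ i * ((L : ℝ) ^ i) ^ α
            * Real.exp (-(δ / 2 * (m * (L : ℝ) ^ i / (L : ℝ) ^ K)))) := mul_le_mul_of_nonneg_left hsplit hC.le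
    _ ≤ C * (Real.exp (δ / 2) * Real.exp (-(δ / 2 * Dm))
            * (Kp * (((L : ℝ) ^ K / m) ^ (d + 1) * ((L : ℝ) ^ K / m) ^ α))) :=
        mul_le_mul_of_nonneg_left (mul_le_mul_of_nonneg_left hsum hE) hC.le
    _ = C * Real.exp (δ / 2) * Kp * (((L : ℝ) ^ K / m) ^ (d + 1) * ((L : ℝ) ^ K / m) ^ α) * Real.exp (-(δ / 2 * Dm)) := by
        ring

/-- **The same with the Hölder difference in the SECOND argument** — the form in which the kernel of `F(x) = N·((A₀⁻¹∇*_μλ)(x + e_ν) − (A₀⁻¹∇*_μλ)(x))`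
appears in part V-b `inv_deriv_adjDeriv_eq_sum` (`F(x) = Σ_y N^{−(d+1)}·DD(y, x)·λ(y)`, `DD(y, x) = N(N[G(y + e_μ, x + e_ν) − G(y, x + e_ν)] − N[G(y + e_μ, x)
− G(y, x)])`): for `y ≠ x, x′`, `(|x − x′|∕N)^{−α}·|DD(y, x′) − DD(y, x)| ≤ C·((L^K)∕m)^{d+1}((L^K)∕m)^α·e^{−δ·min(|B(x) − B(y)|, |B(x′) − B(y)|)}` — the previous
theorem after the symmetry `G(u, v) = G(v, u)` (Q4a `constrainedProp_symm`), which exchanges the roles of the two difference directions.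
[cite: King1986, (2.13) p.653 (symmetry of `G`), Prop. 3.7 (3.65) p.663; Balaban1985BackgroundPropagators, Thm 3.1 (3.45) p.398] -/
theorem fullPropDD_holder_powerLaw_decay_unif_snd (hLodd : Odd L) (hL : 2 ≤ L) {a : ℝ} (ha : 0 < a) {m0sq : ℝ}
    (hm0 : 0 ≤ m0sq) {α : ℝ} (hα0 : 0 < α) (hα1 : α < 1) :
    ∃ C δ : ℝ, 0 < C ∧ 0 < δ ∧ ∀ (K : ℕ), 1 ≤ K → ∀ (N : ℕ) [NeZero N], N = L ^ K →
      ∀ (e : ℕ) (M : Fin (d + 1) → ℕ) [∀ μ, NeZero (M μ)], (∀ μ, M μ = 2 * L ^ e) →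
      ∀ (msq : ℝ), 0 < msq → msq ≤ m0sq → ∀ (μ ν : Fin (d + 1)) (x x' y : Tor (fine N M)), x ≠ y → x' ≠ y →
        (tdistT (fine N M) x x' / (N : ℝ)) ^ (-α) *
          |(N : ℝ) * ((N : ℝ) * (constrainedProp N M (aK a L K) (((N : ℕ) : ℝ) ^ 2) msq (y + unitVec (fine N M) μ) (x' + unitVec (fine N M) ν)
              - constrainedProp N M (aK a L K) (((N : ℕ) : ℝ) ^ 2) msq y (x' + unitVec (fine N M) ν))
            - (N : ℝ) * (constrainedProp N M (aK a L K) (((N : ℕ) : ℝ) ^ 2) msq (y + unitVec (fine N M) μ) x'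
              - constrainedProp N M (aK a L K) (((N : ℕ) : ℝ) ^ 2) msq y x'))
            - ((N : ℝ) * ((N : ℝ) * (constrainedProp N M (aK a L K) (((N : ℕ) : ℝ) ^ 2) msq (y + unitVec (fine N M) μ) (x + unitVec (fine N M) ν)
              - constrainedProp N M (aK a L K) (((N : ℕ) : ℝ) ^ 2) msq y (x + unitVec (fine N M) ν))
            - (N : ℝ) * (constrainedProp N M (aK a L K) (((N : ℕ) : ℝ) ^ 2) msq (y + unitVec (fine N M) μ) x
              - constrainedProp N M (aK a L K) (((N : ℕ) : ℝ) ^ 2) msq y x)))|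
          ≤ C * (((L : ℝ) ^ K / min (tdistT (fine N M) x y) (tdistT (fine N M) x' y)) ^ (d + 1)
                * ((L : ℝ) ^ K / min (tdistT (fine N M) x y) (tdistT (fine N M) x' y)) ^ α)
              * Real.exp (-(δ * min (tdistT M (blockOf N M x) (blockOf N M y)) (tdistT M (blockOf N M x') (blockOf N M y)))) := by
  obtain ⟨C, δ, hC, hδ, H⟩ := fullPropDD_holder_powerLaw_decay_unif (d := d) L hLodd hL ha hm0 hα0 hα1
  refine ⟨C, δ, hC, hδ, ?_⟩
  intro K hK N _ hN e M _ hM msq hmsq hcap μ ν x x' y hxy hx'y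
  have h := H K hK N hN e M hM msq hmsq hcap ν μ x x' y hxy hx'y
  rw [constrainedProp_symm N M _ _ _ (y + unitVec (fine N M) μ) (x' + unitVec (fine N M) ν),
    constrainedProp_symm N M _ _ _ y (x' + unitVec (fine N M) ν),
    constrainedProp_symm N M _ _ _ (y + unitVec (fine N M) μ) x',
    constrainedProp_symm N M _ _ _ y x',
    constrainedProp_symm N M _ _ _ (y + unitVec (fine N M) μ) (x + unitVec (fine N M) ν),
    constrainedProp_symm N M _ _ _ y (x + unitVec (fine N M) ν),
    constrainedProp_symm N M _ _ _ (y + unitVec (fine N M) μ) x,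
    constrainedProp_symm N M _ _ _ y x]
  convert h using 3
  ring

/-! ## §2 Torus geometry, uniformly in the periods: integrality, ball counts, dyadic tail sums -/

omit [NeZero L] in
/-- The torus distance is a natural number. [folklore] -/
theorem exists_natCast_eq_tdistT {dd : ℕ} (K : Fin dd → ℕ) [∀ μ, NeZero (K μ)] (x y : Tor K) :
    ∃ n : ℕ, tdistT K x y = n := ⟨_, rfl⟩

omit [NeZero L] in
/-- The torus distance is at most the largest period. [folklore] -/
theorem tdist_le_sup_period {dd : ℕ} {N : Fin dd → ℕ} (x y : TSite dd N) :
    tdist N x y ≤ ((Finset.univ.sup N : ℕ) : ℝ) := by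
  unfold tdist
  have h : Finset.univ.sup (ccoord N x y) ≤ Finset.univ.sup N := by
    refine Finset.sup_le fun i _ => ?_
    have h1 : ccoord N x y i ≤ N i := by
      unfold ccoord
      have hNi : 1 ≤ N i := Fin.pos (x i)
      have h2 := two_mul_circAbs_le (N i) (((x i).val : ℤ) - ((y i).val : ℤ))
      have h3 := circAbs_nonneg hNi (((x i).val : ℤ) - ((y i).val : ℤ))
      omega
    exact h1.trans (Finset.le_sup (Finset.mem_univ i))
  exact_mod_cast h

omit [NeZero L] in
/-- **Ball counts on King's tori**: `#{y ∈ Tor K : |y − x| ≤ r} ≤ (2⌊r⌋₊ + 1)^{d′}` — the tree's `B5TorusCover.ballCard_le` transported through the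
injection `toSite` (`tdistT = tdist ∘ toSite`). [folklore] -/
theorem card_ball_tdistT_le {dd : ℕ} (K : Fin dd → ℕ) [∀ μ, NeZero (K μ)] (x : Tor K) {r : ℝ} (hr : 0 ≤ r) :
    (Finset.univ.filter fun y : Tor K => tdistT K x y ≤ r).card ≤ (2 * ⌊r⌋₊ + 1) ^ dd := by
  classical
  have hb := ballCard_le (one_le_period K) (toSite K x) hr
  refine le_trans ?_ hb
  rw [← Finset.card_image_of_injective _ (toSite_injective K)]
  refine Finset.card_le_card ?_
  intro w hw
  rw [Finset.mem_image] at hw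
  obtain ⟨y, hy, rfl⟩ := hw
  rw [Finset.mem_filter] at hy ⊢
  exact ⟨Finset.mem_univ _, hy.2⟩

omit [NeZero L] in
/-- The dyadic tail, truncated: if every distance from `x` is `≤ 2^{k+n}`, then `Σ_{|y−x| > 2^k}|y − x|^{−t−d′} ≤ 5^{d′}·Σ_{j ∈ [k, k+n)}(2^{−t})^j`
(induction on `n`; one dyadic shell = part Ω `tdist_rpow_shell_le` at `θ = −t`). [folklore] -/
theorem tdist_rpow_tail_le_aux {dd : ℕ} {N : Fin dd → ℕ} (hN : ∀ i, 1 ≤ N i) (x : TSite dd N) {t : ℝ} (ht : 0 < t) (n : ℕ) :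
    ∀ k : ℕ, (∀ y, tdist N x y ≤ (2 : ℝ) ^ (k + n)) →
      ∑ y ∈ Finset.univ.filter (fun y : TSite dd N => (2 : ℝ) ^ k < tdist N x y), tdist N x y ^ (-t - dd)
        ≤ (5 : ℝ) ^ dd * ∑ j ∈ Finset.Ico k (k + n), ((2 : ℝ) ^ (-t)) ^ j := by
  induction n with
  | zero =>
    intro k hk
    have hempty : Finset.univ.filter (fun y : TSite dd N => (2 : ℝ) ^ k < tdist N x y) = ∅ := by
      refine Finset.filter_eq_empty_iff.mpr fun y _ => not_lt.mpr ?_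
      have := hk y
      rwa [add_zero] at this
    rw [hempty, Finset.sum_empty, add_zero, Finset.Ico_self, Finset.sum_empty, mul_zero]
  | succ n IH =>
    intro k hk
    -- split the tail at `2^{k+1}`: the shell `(2^k, 2^{k+1}]` and the tail beyond `2^{k+1}`
    have hsplit := (Finset.sum_filter_add_sum_filter_not (Finset.univ.filter (fun y : TSite dd N => (2 : ℝ) ^ k < tdist N x y))
      (fun y : TSite dd N => tdist N x y ≤ (2 : ℝ) ^ (k + 1)) (fun y => tdist N x y ^ (-t - dd))).symm
    have hshell : (Finset.univ.filter (fun y : TSite dd N => (2 : ℝ) ^ k < tdist N x y)).filter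
          (fun y : TSite dd N => tdist N x y ≤ (2 : ℝ) ^ (k + 1))
        = Finset.univ.filter (fun y : TSite dd N => (2 : ℝ) ^ k < tdist N x y ∧ tdist N x y ≤ (2 : ℝ) ^ (k + 1)) := by
      rw [Finset.filter_filter]
    have htail : (Finset.univ.filter (fun y : TSite dd N => (2 : ℝ) ^ k < tdist N x y)).filter
          (fun y : TSite dd N => ¬ tdist N x y ≤ (2 : ℝ) ^ (k + 1))
        = Finset.univ.filter (fun y : TSite dd N => (2 : ℝ) ^ (k + 1) < tdist N x y) := by
      rw [Finset.filter_filter]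
      refine Finset.filter_congr fun y _ => ⟨fun h => not_le.mp h.2, fun h => ⟨?_, not_le.mpr h⟩⟩
      have : (2 : ℝ) ^ k ≤ (2 : ℝ) ^ (k + 1) := pow_le_pow_right₀ (by norm_num) (by omega)
      linarith
    rw [hsplit, hshell, htail]
    have h1 := tdist_rpow_shell_le hN x (θ := -t) (by have : (0 : ℝ) ≤ dd := Nat.cast_nonneg _; linarith) k
    have h2 := IH (k + 1) (fun y => by have := hk y; rwa [show k + (n + 1) = k + 1 + n by ring] at this)
    rw [Finset.sum_eq_sum_Ico_succ_bot (by omega : k < k + (n + 1)), show k + (n + 1) = k + 1 + n by ring, mul_add]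
    exact add_le_add h1 h2

omit [NeZero L] in
/-- **DYADIC TAIL SUMS ON THE TORUS**: for every period vector (all `N_i ≥ 1`), centre `x`, `t > 0` and `k`:
`Σ_{|y−x| > 2^k}|y − x|^{−t−d′} ≤ 5^{d′}·(2^{−t})^k∕(1 − 2^{−t})` — uniformly in the periods (the far-field counting input of the Calderón–Zygmund
split behind [B9] (3.45) at `U ≡ 1`). [folklore] -/
theorem tdist_rpow_tail_le {dd : ℕ} {N : Fin dd → ℕ} (hN : ∀ i, 1 ≤ N i) (x : TSite dd N) {t : ℝ} (ht : 0 < t) (k : ℕ) :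
    ∑ y ∈ Finset.univ.filter (fun y : TSite dd N => (2 : ℝ) ^ k < tdist N x y), tdist N x y ^ (-t - dd)
      ≤ (5 : ℝ) ^ dd * (((2 : ℝ) ^ (-t)) ^ k / (1 - (2 : ℝ) ^ (-t))) := by
  -- every distance is `≤ sup N ≤ 2^{sup N} ≤ 2^{k + sup N}`
  set n : ℕ := Finset.univ.sup N with hn
  have hk : ∀ y, tdist N x y ≤ (2 : ℝ) ^ (k + n) := fun y => by
    have h1 := tdist_le_sup_period x y
    have h2 : ((n : ℕ) : ℝ) ≤ (2 : ℝ) ^ n := by exact_mod_cast (Nat.lt_two_pow_self).le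
    have h3 : (2 : ℝ) ^ n ≤ (2 : ℝ) ^ (k + n) := pow_le_pow_right₀ (by norm_num) (by omega)
    exact h1.trans (h2.trans h3)
  have h := tdist_rpow_tail_le_aux hN x ht n k hk
  have hq0 : 0 ≤ (2 : ℝ) ^ (-t) := Real.rpow_nonneg (by norm_num) _
  have hq1 : (2 : ℝ) ^ (-t) < 1 := Real.rpow_lt_one_of_one_lt_of_neg (by norm_num) (by linarith)
  have hgeom := geom_sum_Ico_le_of_lt_one (m := k) (n := k + n) hq0 hq1
  exact h.trans (mul_le_mul_of_nonneg_left hgeom (by positivity))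

omit [NeZero L] in
/-- ★ **DYADIC TAIL SUMS ON KING'S TORI, REAL THRESHOLD**: for `t > 0`, `S ≥ 1`, every `Tor K` and centre `x`:
`Σ_{y : S < |y − x|}|y − x|^{−t−d′} ≤ (5^{d′}·2^t∕(1 − 2^{−t}))·S^{−t}` — `2^k ≤ S < 2^{k+1}` with `k = log₂⌊S⌋`, the tail beyond `2^k`, transported through
`toSite`. [folklore] -/
theorem powerSum_tail_le_tdistT {dd : ℕ} (K : Fin dd → ℕ) [∀ μ, NeZero (K μ)] (x : Tor K) {t : ℝ} (ht : 0 < t)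
    {S : ℝ} (hS : 1 ≤ S) :
    ∑ y ∈ Finset.univ.filter (fun y : Tor K => S < tdistT K x y), tdistT K x y ^ (-t - dd)
      ≤ (5 : ℝ) ^ dd * (2 : ℝ) ^ t / (1 - (2 : ℝ) ^ (-t)) * S ^ (-t) := by
  classical
  -- the dyadic scale `2^k ≤ S < 2^{k+1}`
  set k : ℕ := Nat.log 2 ⌊S⌋₊ with hk
  have hS0 : 0 < S := by linarith
  have hfl1 : 1 ≤ ⌊S⌋₊ := Nat.one_le_iff_ne_zero.mpr (Nat.pos_iff_ne_zero.mp (Nat.floor_pos.mpr hS))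
  have h2k_le : (2 : ℝ) ^ k ≤ S := by
    have h1 : 2 ^ k ≤ ⌊S⌋₊ := Nat.pow_log_le_self 2 (by omega)
    have h2 : ((2 ^ k : ℕ) : ℝ) ≤ (⌊S⌋₊ : ℝ) := by exact_mod_cast h1
    push_cast at h2
    exact h2.trans (Nat.floor_le hS0.le)
  have hS_lt : S < (2 : ℝ) ^ (k + 1) := by
    have h1 : ⌊S⌋₊ < 2 ^ (k + 1) := Nat.lt_pow_succ_log_self (by norm_num) _
    have h2 : (⌊S⌋₊ : ℝ) + 1 ≤ ((2 ^ (k + 1) : ℕ) : ℝ) := by exact_mod_cast h1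
    push_cast at h2
    linarith [Nat.lt_floor_add_one S]
  have h2k0 : (0 : ℝ) < (2 : ℝ) ^ k := by positivity
  -- `(2^k)^{−t} ≤ 2^t·S^{−t}` since `2^k > S∕2`
  have hpow : ((2 : ℝ) ^ (-t)) ^ k ≤ (2 : ℝ) ^ t * S ^ (-t) := by
    have e1 : ((2 : ℝ) ^ (-t)) ^ k = ((2 : ℝ) ^ k) ^ (-t) := by
      rw [← Real.rpow_natCast ((2 : ℝ) ^ (-t)) k, ← Real.rpow_mul (by norm_num), mul_comm, Real.rpow_mul (by norm_num),
        Real.rpow_natCast]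
    have e2 : (2 : ℝ) ^ t * S ^ (-t) = (S / 2) ^ (-t) := by
      rw [Real.div_rpow hS0.le (by norm_num), Real.rpow_neg (by norm_num : (0:ℝ) ≤ 2), div_eq_mul_inv, inv_inv, mul_comm]
    rw [e1, e2]
    have hS2 : S / 2 ≤ (2 : ℝ) ^ k := by rw [pow_succ] at hS_lt; linarith
    exact Real.rpow_le_rpow_of_nonpos (by positivity) hS2 (by linarith)
  -- the sum over `Tor K` injects into the TSite tail beyond `2^k`
  have htail := tdist_rpow_tail_le (one_le_period K) (toSite K x) ht k
  have himg : ∑ y ∈ Finset.univ.filter (fun y : Tor K => S < tdistT K x y), tdistT K x y ^ (-t - dd)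
      = ∑ w ∈ (Finset.univ.filter (fun y : Tor K => S < tdistT K x y)).image (toSite K),
          tdist K (toSite K x) w ^ (-t - dd) := by
    rw [Finset.sum_image (fun a _ b _ hab => toSite_injective K hab)]
    rfl
  have hsub : ∑ w ∈ (Finset.univ.filter (fun y : Tor K => S < tdistT K x y)).image (toSite K),
          tdist K (toSite K x) w ^ (-t - dd)
      ≤ ∑ y ∈ Finset.univ.filter (fun y : TSite dd K => (2 : ℝ) ^ k < tdist K (toSite K x) y), tdist K (toSite K x) y ^ (-t - dd) := by
    refine Finset.sum_le_sum_of_subset_of_nonneg ?_ (fun w _ _ => Real.rpow_nonneg (tdist_nonneg K _ w) _)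
    intro w hw
    rw [Finset.mem_image] at hw
    obtain ⟨y, hy, rfl⟩ := hw
    rw [Finset.mem_filter] at hy ⊢
    exact ⟨Finset.mem_univ _, lt_of_le_of_lt h2k_le hy.2⟩
  have hc0 : 0 ≤ (5 : ℝ) ^ dd / (1 - (2 : ℝ) ^ (-t)) := by
    have hq1 : (2 : ℝ) ^ (-t) < 1 := Real.rpow_lt_one_of_one_lt_of_neg (by norm_num) (by linarith)
    exact div_nonneg (by positivity) (by linarith)
  rw [himg]
  calc _ ≤ _ := hsub
    _ ≤ (5 : ℝ) ^ dd * (((2 : ℝ) ^ (-t)) ^ k / (1 - (2 : ℝ) ^ (-t))) := htail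
    _ = (5 : ℝ) ^ dd / (1 - (2 : ℝ) ^ (-t)) * ((2 : ℝ) ^ (-t)) ^ k := by ring
    _ ≤ (5 : ℝ) ^ dd / (1 - (2 : ℝ) ^ (-t)) * ((2 : ℝ) ^ t * S ^ (-t)) := mul_le_mul_of_nonneg_left hpow hc0
    _ = (5 : ℝ) ^ dd * (2 : ℝ) ^ t / (1 - (2 : ℝ) ^ (-t)) * S ^ (-t) := by ring

end Summit.QuantumFields.YangMills.BalabanUVNodes.N15KingModelRung.Curved
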